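import Literature.MathematicalPhysics.QuantumFieldTheory.Balaban1983to89.B8SockB9P3ShellModeVacuityUniv
import Literature.MathematicalPhysics.QuantumFieldTheory.Balaban1983to89.B8Ineq159FlatCubeMemberPrinted

/-!
# `Balaban1983to89.B8Ineq159FlatShellModeCrossingDatum` — KERNEL CERTIFICATE THAT THE REPAIR BITES (ref-E NOTE-1 on p573921): the common
# `L`-block sum `S` of every interior shell gauge mode of `B8Ineq159FlatShellModeVacuity` is NON-ZERO (energy identity for the flat Laplacian
# `Δ^η_1` on `ℤᵈ`), hence its averaging datum on the CROSSING bond `⟨s − e₀, s⟩` of print's class `B8Ineq159FlatCubeMemberPrinted.cubeLamBP` is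
# `L^{−d}·i·S ≠ 0` — the zero modes that kill the β-edition clauses do NOT inhabit the data of the repaired statement `Ineq159FlatCubeMemberPrinted`

statement-level skeleton of published theorems with citation tags; proofs where landed; nothing here is a claim about the
Yang–Mills mass gap

`[Balaban1984PropagatorsII]` ("B6", CMP **96** (1984) 223–250) (2.11) p. 225 («the Laplace operator Δ is positive on the subspace N(Q′), hence it is
invertible on this subspace»), (2.3) p. 224; `[Balaban1985RegularSpaces]` (1.31) p. 82, (1.38) p. 82, (1.59) p. 86, (1.131) p. 99;
`[Balaban1985BackgroundPropagators]` (3.23) p. 394; `[Balaban1985Averaging]` (2) p. 17, (78) p. 30, (125) p. 36.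

CITATION HEADER (lean-in-tree rule).  Cell `pub-ymgap` (YM Track A, HUMAN RULING D-0062), DAG node N05 = [B8], seat `pub-ymgap-dag-n05-c` (g11),
INTENT-5 (referee ref-E g12 READ-12 NOTE-1 on p573921, bus l.23581: «the repaired fact's non-vacuity AGAINST THE CERTIFIED SHELL MODES is argued, not
kernel-certified — the crossing datum on ⟨s − e₀, s⟩ is i·L^{−d}·S with S the common block sum, and S ≠ 0 by the energy identity; recommend
`shellMode_crossing_datum_ne_zero`»).  THIS FILE proves it.

THE MATHEMATICS (kernel-checked; `Δ^η_1 = B8Eq138LandauZd.covLap η 1`, sums over `ℤᵈ` = `finsum` of finitely supported functions).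
* §1 lattice calculus: `covLap_flat_mul` (the stencil in `ℂ`-multiplicative form), `finsum_shift` (translation invariance), `support_covLap_finite`,
  ★ `finsum_conj_mul_covLap_symm` (`Σ ū·Δv = Σ \overline{Δu}·v`), `finsum_conj_mul_self_eq` ∕ ★ `eq_zero_of_finsum_conj_mul_self_eq_zero` (positivity),
  ★ `finsum_conj_mul_covLap_self` (the Dirichlet form `Σ ū·Δu = η⁻²Σ_μ Σ|u(·+e_μ) − u|²`), ★ `shift_eq_of_finsum_conj_mul_covLap_self_eq_zero`.
* §2 ★★ `shellMode_blockSum_ne_zero`: for a shell mode (`λ ≠ 0` supported in `□₁`, equal block sums `S` over `□₁^{(1)}`, `Δ^η_1(𝟙_{□₀}D^{η*}_1∂λ)` constant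
  on the blocks of `□₁`): `S ≠ 0`.  Proof: the Landau quantity is `(Δ^η_1)²λ` (`B8SockB9P3ShellModeVacuityUniv.indicator_covDivB_grad_eq`); by the block
  decomposition of `□₁` (`Finset.sum_biUnion` over `blockSites`, `B7Eq214FlatQprime.sum_blockSites_eq_sum_boxVec`), `Σ_x λ̄(x)·((Δ^η_1)²λ)(x) = Σ_β c_β·\overline{S_β} =
  \overline{S}·Σ_β c_β`; if `S = 0` this is `0 = Σ|Δ^η_1λ|²` (symmetry), so `Δ^η_1λ = 0`, so the Dirichlet form vanishes, so `λ` is invariant under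
  every lattice translation — impossible for `λ ≠ 0` supported in the finite `□₁`.  ★★ `shellMode_crossing_datum_ne_zero`: the bond `⟨s − e₀, s⟩`
  (`s` = lower corner of `□₁^{(1)}`) belongs to `cubeLamBP … m 1` (p573921) and carries the datum `L·Q₁(1)(iη∂λ) = L^{−d}·i·(S − 0) ≠ 0`
  (`B8SockB9P3ShellModeVacuityUniv.linCovIter_one_grad_level_one`; the outer block `B(s − e₀)` misses `□₁`).

HONEST SCOPE.  Lattice bookkeeping + an energy identity; nothing of Bałaban asserted beyond the elementary positivity (2.11); count-neutral; N05 NOT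
discharged; one finite `T⁴` programme at fixed `ε`, Bałaban as printed; nothing continuum ∕ ℝ⁴ ∕ OS ∕ mass-gap ∕ Clay.  No `sorry`, no `def`, no
`instance`, no `notation`.  Unit `pub-ymgap-dag-n05-c` (g11), 2026-08-27.
-/

noncomputable section

open ComplexConjugate

namespace Literature.MathematicalPhysics.QuantumFieldTheory.Balaban1983to89.B8Ineq159FlatShellModeCrossingDatum

open B7Prop1Explicit B7Prop2Explicit B7Prop1Local
open B8Ineq132 (covDerivFwd Under)
open B8Eq138LandauZd (covLap covDivB)
open B8Eq131Cubes (cube sqLo sqHi mem_cube_iff)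
open B8Eq131CubesAdmissible (smul_mem_cube_iff)
open B8Eq191FlatStencils (covDerivFwd_flat_apply covLap_flat_apply)
open B8Eq191FlatLettersCubeMember (inBox_finite under_iff_blockMap_eq)
open Literature.MathematicalPhysics.QuantumLattice (blockMap blockSites mem_blockSites_iff)

export B7Prop1Explicit (Site)

variable {d : ℕ}

/-! ## §1 Summation by parts on `ℤᵈ` for the flat Laplacian `Δ^η_1 = covLap η 1` (finitely supported functions, `finsum`) -/

/-- The flat Laplacian in `ℂ`-multiplicative form: `(Δ^η_1 f)(x) = Σ_μ η⁻²(2f(x) − f(x+e_μ) − f(x−e_μ))`. [cite: Balaban1985BackgroundPropagators, (3.23) p.394] -/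
theorem covLap_flat_mul (η : ℝ) (f : Site d → ℂ) (x : Site d) :
    covLap η (1 : Site d → Fin d → ℂˣ) f x = ∑ μ : Fin d, ((η : ℂ) ^ 2)⁻¹ * (2 * f x - f (x + e μ) - f (x - e μ)) := by
  rw [covLap_flat_apply]
  refine Finset.sum_congr rfl fun μ _ => ?_
  rw [Complex.real_smul, Complex.real_smul]
  push_cast
  ring

/-- Translation invariance of `finsum` on `ℤᵈ`: `Σ_x F(x + t) = Σ_x F(x)`. [folklore] -/
private theorem finsum_shift (t : Site d) (F : Site d → ℂ) : ∑ᶠ x, F (x + t) = ∑ᶠ x, F x :=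
  finsum_comp_equiv (Equiv.addRight t) (f := F)

/-- The support of `Δ^η_1 f` lies within distance one of the support of `f` (finite if that is). [cite: Balaban1985BackgroundPropagators, (3.23) p.394] -/
theorem support_covLap_finite (η : ℝ) {f : Site d → ℂ} (hf : (Function.support f).Finite) :
    (Function.support (covLap η (1 : Site d → Fin d → ℂˣ) f)).Finite := by
  classical
  refine ((hf.union ((Set.finite_range fun μ : Fin d => e μ).image2 (fun t x => x - t) hf |>.union
    ((Set.finite_range fun μ : Fin d => e μ).image2 (fun t x => x + t) hf)))).subset fun x hx => ?_
  rw [Function.mem_support, covLap_flat_mul] at hx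
  by_contra hx'
  simp only [Set.mem_union, Set.mem_image2, Set.mem_range, Function.mem_support, not_or, not_exists, not_and] at hx'
  obtain ⟨h0, h1, h2⟩ := hx'
  apply hx
  refine Finset.sum_eq_zero fun μ _ => ?_
  have a : f x = 0 := by_contra fun h => h0 h
  have b : f (x + e μ) = 0 := by
    by_contra h
    exact h1 (e μ) ⟨μ, rfl⟩ (x + e μ) h (by abel)
  have c : f (x - e μ) = 0 := by
    by_contra h
    exact h2 (e μ) ⟨μ, rfl⟩ (x - e μ) h (by abel)
  rw [a, b, c]; ring

/-- A `finsum` with a factor `conj (u x)` is a finite sum over any finset containing the support of `u`. [folklore] -/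
private theorem finsum_conj_mul_eq_sum {u : Site d → ℂ} {s : Finset (Site d)} (hs : Function.support u ⊆ ↑s) (G : Site d → ℂ) :
    ∑ᶠ x, conj (u x) * G x = ∑ x ∈ s, conj (u x) * G x := by
  refine finsum_eq_sum_of_support_subset _ fun x hx => hs ?_
  rw [Function.mem_support] at hx ⊢
  intro h; apply hx; rw [h, map_zero, zero_mul]

/-- A `finsum` with a factor `v x` is a finite sum over any finset containing the support of `v`. [folklore] -/
private theorem finsum_mul_right_eq_sum {v : Site d → ℂ} {s : Finset (Site d)} (hs : Function.support v ⊆ ↑s) (G : Site d → ℂ) :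
    ∑ᶠ x, G x * v x = ∑ x ∈ s, G x * v x := by
  refine finsum_eq_sum_of_support_subset _ fun x hx => hs ?_
  rw [Function.mem_support] at hx ⊢
  intro h; apply hx; rw [h, mul_zero]

/-- Distributing a constant over a three-term combination of finite sums (bookkeeping). [folklore] -/
private theorem mul_three_sums (s : Finset (Site d)) (c : ℂ) (A B C : Site d → ℂ) :
    ∑ x ∈ s, c * (2 * A x - B x - C x) = c * (2 * ∑ x ∈ s, A x - ∑ x ∈ s, B x - ∑ x ∈ s, C x) := by
  simp only [mul_sub, Finset.mul_sum, Finset.sum_sub_distrib]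

/-- ★ **`Δ^η_1` IS SYMMETRIC on finitely supported functions of `ℤᵈ`**: `Σ_x \\overline{u(x)}(Δv)(x) = Σ_x \\overline{(Δu)(x)}v(x)` (translation
invariance of the lattice sums). [cite: Balaban1985BackgroundPropagators, (3.23) p.394; Balaban1984PropagatorsII, (2.11) p.225] -/
theorem finsum_conj_mul_covLap_symm (η : ℝ) {u v : Site d → ℂ} (hu : (Function.support u).Finite) (hv : (Function.support v).Finite) :
    ∑ᶠ x, conj (u x) * covLap η (1 : Site d → Fin d → ℂˣ) v x = ∑ᶠ x, conj (covLap η (1 : Site d → Fin d → ℂˣ) u x) * v x := by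
  classical
  set c : ℂ := ((η : ℂ) ^ 2)⁻¹ with hc
  have hcreal : conj c = c := by rw [hc]; simp [Complex.conj_ofReal]
  -- the three model sums
  have hA : ∀ μ : Fin d, ∑ᶠ x, conj (u x) * v (x + e μ) = ∑ᶠ x, conj (u (x - e μ)) * v x := by
    intro μ
    rw [← finsum_shift (e μ) (fun x => conj (u (x - e μ)) * v x)]
    simp only [add_sub_cancel_right]
  have hB : ∀ μ : Fin d, ∑ᶠ x, conj (u x) * v (x - e μ) = ∑ᶠ x, conj (u (x + e μ)) * v x := by
    intro μ
    rw [← finsum_shift (-(e μ)) (fun x => conj (u (x + e μ)) * v x)]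
    simp only [← sub_eq_add_neg, sub_add_cancel]
  -- supports
  set Su := hu.toFinset with hSu
  set Sv := hv.toFinset with hSv
  have hSu' : Function.support u ⊆ ↑Su := by rw [hSu, Set.Finite.coe_toFinset]
  have hSv' : Function.support v ⊆ ↑Sv := by rw [hSv, Set.Finite.coe_toFinset]
  -- left side
  have hL : ∑ᶠ x, conj (u x) * covLap η (1 : Site d → Fin d → ℂˣ) v x =
      ∑ μ : Fin d, c * (2 * ∑ᶠ x, conj (u x) * v x - ∑ᶠ x, conj (u x) * v (x + e μ) - ∑ᶠ x, conj (u x) * v (x - e μ)) := by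
    rw [finsum_conj_mul_eq_sum hSu']
    simp_rw [covLap_flat_mul, Finset.mul_sum]
    rw [Finset.sum_comm]
    refine Finset.sum_congr rfl fun μ _ => ?_
    rw [finsum_conj_mul_eq_sum hSu', finsum_conj_mul_eq_sum hSu', finsum_conj_mul_eq_sum hSu', ← mul_three_sums]
    refine Finset.sum_congr rfl fun x _ => ?_
    ring
  -- right side
  have hR : ∑ᶠ x, conj (covLap η (1 : Site d → Fin d → ℂˣ) u x) * v x =
      ∑ μ : Fin d, c * (2 * ∑ᶠ x, conj (u x) * v x - ∑ᶠ x, conj (u (x + e μ)) * v x - ∑ᶠ x, conj (u (x - e μ)) * v x) := by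
    rw [finsum_mul_right_eq_sum hSv']
    simp_rw [covLap_flat_mul, map_sum, Finset.sum_mul]
    rw [Finset.sum_comm]
    refine Finset.sum_congr rfl fun μ _ => ?_
    rw [finsum_mul_right_eq_sum hSv' (fun x => conj (u x)), finsum_mul_right_eq_sum hSv' (fun x => conj (u (x + e μ))),
      finsum_mul_right_eq_sum hSv' (fun x => conj (u (x - e μ))), ← mul_three_sums]
    refine Finset.sum_congr rfl fun x _ => ?_
    rw [map_mul, hcreal, map_sub, map_sub, map_mul]
    simp only [map_ofNat]
    ring
  rw [hL, hR]
  refine Finset.sum_congr rfl fun μ _ => ?_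
  rw [hA μ, hB μ]
  ring


/-- A `finsum` with a left factor `u x` is a finite sum over any finset containing the support of `u`. [folklore] -/
private theorem finsum_mul_left_eq_sum {u : Site d → ℂ} {s : Finset (Site d)} (hs : Function.support u ⊆ ↑s) (G : Site d → ℂ) :
    ∑ᶠ x, u x * G x = ∑ x ∈ s, u x * G x := by
  refine finsum_eq_sum_of_support_subset _ fun x hx => hs ?_
  rw [Function.mem_support] at hx ⊢
  intro h; apply hx; rw [h, zero_mul]

/-- ★ **`Δ^η_1` IS SYMMETRIC for the BILINEAR lattice pairing** `Σ_x u(x)(Δv)(x) = Σ_x (Δu)(x)v(x)` (finitely supported `u, v`; real stencil, so no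
conjugation is needed) — the form in which the Landau condition (1.38) «R D* A = 0» pairs `D*A` against `Δλ`, `λ ∈ N(Q′)`.
[cite: Balaban1984PropagatorsII, (2.9)–(2.12) p.224–225; Balaban1985BackgroundPropagators, (3.23)–(3.25) p.394] -/
theorem finsum_mul_covLap_symm (η : ℝ) {u v : Site d → ℂ} (hu : (Function.support u).Finite) (hv : (Function.support v).Finite) :
    ∑ᶠ x, u x * covLap η (1 : Site d → Fin d → ℂˣ) v x = ∑ᶠ x, covLap η (1 : Site d → Fin d → ℂˣ) u x * v x := by
  classical
  set c : ℂ := ((η : ℂ) ^ 2)⁻¹ with hc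
  have hA : ∀ μ : Fin d, ∑ᶠ x, u x * v (x + e μ) = ∑ᶠ x, u (x - e μ) * v x := by
    intro μ
    rw [← finsum_shift (e μ) (fun x => u (x - e μ) * v x)]
    simp only [add_sub_cancel_right]
  have hB : ∀ μ : Fin d, ∑ᶠ x, u x * v (x - e μ) = ∑ᶠ x, u (x + e μ) * v x := by
    intro μ
    rw [← finsum_shift (-(e μ)) (fun x => u (x + e μ) * v x)]
    simp only [← sub_eq_add_neg, sub_add_cancel]
  set Su := hu.toFinset with hSu
  set Sv := hv.toFinset with hSv
  have hSu' : Function.support u ⊆ ↑Su := by rw [hSu, Set.Finite.coe_toFinset]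
  have hSv' : Function.support v ⊆ ↑Sv := by rw [hSv, Set.Finite.coe_toFinset]
  have hL : ∑ᶠ x, u x * covLap η (1 : Site d → Fin d → ℂˣ) v x =
      ∑ μ : Fin d, c * (2 * ∑ᶠ x, u x * v x - ∑ᶠ x, u x * v (x + e μ) - ∑ᶠ x, u x * v (x - e μ)) := by
    rw [finsum_mul_left_eq_sum hSu']
    simp_rw [covLap_flat_mul, Finset.mul_sum]
    rw [Finset.sum_comm]
    refine Finset.sum_congr rfl fun μ _ => ?_
    rw [finsum_mul_left_eq_sum hSu', finsum_mul_left_eq_sum hSu', finsum_mul_left_eq_sum hSu', ← mul_three_sums]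
    refine Finset.sum_congr rfl fun x _ => ?_
    ring
  have hR : ∑ᶠ x, covLap η (1 : Site d → Fin d → ℂˣ) u x * v x =
      ∑ μ : Fin d, c * (2 * ∑ᶠ x, u x * v x - ∑ᶠ x, u (x + e μ) * v x - ∑ᶠ x, u (x - e μ) * v x) := by
    rw [finsum_mul_right_eq_sum hSv']
    simp_rw [covLap_flat_mul, Finset.sum_mul]
    rw [Finset.sum_comm]
    refine Finset.sum_congr rfl fun μ _ => ?_
    rw [finsum_mul_right_eq_sum hSv' (fun x => u x), finsum_mul_right_eq_sum hSv' (fun x => u (x + e μ)),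
      finsum_mul_right_eq_sum hSv' (fun x => u (x - e μ)), ← mul_three_sums]
    refine Finset.sum_congr rfl fun x _ => ?_
    ring
  rw [hL, hR]
  refine Finset.sum_congr rfl fun μ _ => ?_
  rw [hA μ, hB μ]
  ring

/-- `Σ_x \\overline{w(x)}w(x)` is the (real, non-negative) sum of `‖w(x)‖²` over the support (the positivity behind (2.11)). [cite: Balaban1984PropagatorsII, (2.11) p.225] -/
theorem finsum_conj_mul_self_eq {w : Site d → ℂ} (hw : (Function.support w).Finite) :
    ∑ᶠ x, conj (w x) * w x = ((∑ x ∈ hw.toFinset, ‖w x‖ ^ 2 : ℝ) : ℂ) := by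
  rw [finsum_conj_mul_eq_sum (s := hw.toFinset) (by rw [Set.Finite.coe_toFinset])]
  push_cast
  refine Finset.sum_congr rfl fun x _ => ?_
  rw [Complex.conj_mul']

/-- ★ **POSITIVITY**: `Σ_x \\overline{w(x)}w(x) = 0` for a finitely supported `w` forces `w = 0` (the positivity behind (2.11)). [cite: Balaban1984PropagatorsII, (2.11) p.225] -/
theorem eq_zero_of_finsum_conj_mul_self_eq_zero {w : Site d → ℂ} (hw : (Function.support w).Finite)
    (h : ∑ᶠ x, conj (w x) * w x = 0) : w = 0 := by
  rw [finsum_conj_mul_self_eq hw] at h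
  have h' : ∑ x ∈ hw.toFinset, ‖w x‖ ^ 2 = 0 := by exact_mod_cast h
  have hall := (Finset.sum_eq_zero_iff_of_nonneg fun x _ => sq_nonneg ‖w x‖).1 h'
  funext x
  by_cases hx : x ∈ hw.toFinset
  · have := hall x hx
    rwa [sq_eq_zero_iff, norm_eq_zero] at this
  · rw [Set.Finite.mem_toFinset, Function.mem_support, not_not] at hx
    exact hx

/-- ★ **THE DIRICHLET FORM**: `Σ_x \\overline{u(x)}(Δ^η_1u)(x) = η⁻²Σ_μ Σ_x |u(x+e_μ) − u(x)|²`. [cite: Balaban1984PropagatorsII, (2.11) p.225; Balaban1985BackgroundPropagators, (3.23) p.394] -/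
theorem finsum_conj_mul_covLap_self (η : ℝ) {u : Site d → ℂ} (hu : (Function.support u).Finite) :
    ∑ᶠ x, conj (u x) * covLap η (1 : Site d → Fin d → ℂˣ) u x =
      ∑ μ : Fin d, ((η : ℂ) ^ 2)⁻¹ * ∑ᶠ x, conj (u (x + e μ) - u x) * (u (x + e μ) - u x) := by
  classical
  set c : ℂ := ((η : ℂ) ^ 2)⁻¹ with hc
  set Su := hu.toFinset with hSu
  have hSu' : Function.support u ⊆ ↑Su := by rw [hSu, Set.Finite.coe_toFinset]
  -- finite supports of the shifted differences
  have hgrad : ∀ μ : Fin d, (Function.support fun x => u (x + e μ) - u x).Finite := by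
    intro μ
    refine (hu.union (hu.image fun x => x - e μ)).subset fun x hx => ?_
    rw [Function.mem_support] at hx
    by_contra h
    simp only [Set.mem_union, Function.mem_support, Set.mem_image, not_or, not_exists, not_and, not_not] at h
    apply hx
    have h1 : u x = 0 := h.1
    have h2 : u (x + e μ) = 0 := by
      by_contra h2
      exact h.2 (x + e μ) h2 (by abel)
    rw [h1, h2, sub_zero]
  -- expand both sides into the model sums
  have hA : ∀ μ : Fin d, ∑ᶠ x, conj (u (x + e μ)) * u (x + e μ) = ∑ᶠ x, conj (u x) * u x := fun μ =>
    finsum_shift (e μ) (fun x => conj (u x) * u x)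
  have hB : ∀ μ : Fin d, ∑ᶠ x, conj (u (x + e μ)) * u x = ∑ᶠ x, conj (u x) * u (x - e μ) := by
    intro μ
    rw [← finsum_shift (e μ) (fun x => conj (u x) * u (x - e μ))]
    simp only [add_sub_cancel_right]
  have hL : ∑ᶠ x, conj (u x) * covLap η (1 : Site d → Fin d → ℂˣ) u x =
      ∑ μ : Fin d, c * (2 * ∑ᶠ x, conj (u x) * u x - ∑ᶠ x, conj (u x) * u (x + e μ) - ∑ᶠ x, conj (u x) * u (x - e μ)) := by
    rw [finsum_conj_mul_eq_sum hSu']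
    simp_rw [covLap_flat_mul, Finset.mul_sum]
    rw [Finset.sum_comm]
    refine Finset.sum_congr rfl fun μ _ => ?_
    rw [finsum_conj_mul_eq_sum hSu', finsum_conj_mul_eq_sum hSu', finsum_conj_mul_eq_sum hSu', ← mul_three_sums]
    refine Finset.sum_congr rfl fun x _ => ?_
    ring
  have hR : ∀ μ : Fin d, ∑ᶠ x, conj (u (x + e μ) - u x) * (u (x + e μ) - u x) =
      2 * ∑ᶠ x, conj (u x) * u x - ∑ᶠ x, conj (u x) * u (x + e μ) - ∑ᶠ x, conj (u x) * u (x - e μ) := by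
    intro μ
    -- all four products have support inside `Su ∪ (Su − e_μ)`
    set T := Su ∪ Su.image (fun x => x - e μ) with hT
    have hT1 : Function.support u ⊆ ↑T := fun x hx => by
      rw [hT, Finset.coe_union]; exact Or.inl (hSu' hx)
    have hT2 : Function.support (fun x => u (x + e μ)) ⊆ ↑T := fun x hx => by
      rw [hT, Finset.coe_union, Finset.coe_image]
      refine Or.inr ⟨x + e μ, hSu' hx, by simp⟩
    have hT3 : Function.support (fun x => u (x + e μ) - u x) ⊆ ↑T := fun x hx => by
      rw [Function.mem_support] at hx
      by_cases h1 : u x = 0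
      · have : u (x + e μ) ≠ 0 := fun h2 => hx (by rw [h1, h2, sub_zero])
        exact hT2 this
      · exact hT1 h1
    rw [finsum_conj_mul_eq_sum hT3, finsum_conj_mul_eq_sum hT1, finsum_conj_mul_eq_sum hT1, finsum_conj_mul_eq_sum hT1]
    have hshift : ∑ x ∈ T, conj (u (x + e μ)) * u (x + e μ) = ∑ x ∈ T, conj (u x) * u x := by
      rw [← finsum_conj_mul_eq_sum hT2 (fun x => u (x + e μ)), ← finsum_conj_mul_eq_sum hT1, hA μ]
    have hshift' : ∑ x ∈ T, conj (u (x + e μ)) * u x = ∑ x ∈ T, conj (u x) * u (x - e μ) := by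
      rw [← finsum_conj_mul_eq_sum hT2 (fun x => u x), ← finsum_conj_mul_eq_sum hT1, hB μ]
    calc ∑ x ∈ T, conj (u (x + e μ) - u x) * (u (x + e μ) - u x)
        = ∑ x ∈ T, conj (u (x + e μ)) * u (x + e μ) - ∑ x ∈ T, conj (u (x + e μ)) * u x
            - ∑ x ∈ T, conj (u x) * u (x + e μ) + ∑ x ∈ T, conj (u x) * u x := by
          rw [← Finset.sum_sub_distrib, ← Finset.sum_sub_distrib, ← Finset.sum_add_distrib]
          refine Finset.sum_congr rfl fun x _ => ?_
          rw [map_sub]; ring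
      _ = _ := by rw [hshift, hshift']; ring
  rw [hL]
  refine Finset.sum_congr rfl fun μ _ => ?_
  rw [hR μ]

/-- ★ **A finitely supported `u` with `Σ_x \\overline{u}Δ^η_1u = 0` is translation invariant in every direction** (hence `0`, used below).
[cite: Balaban1984PropagatorsII, (2.11) p.225] -/
theorem shift_eq_of_finsum_conj_mul_covLap_self_eq_zero {η : ℝ} (hη : η ≠ 0) {u : Site d → ℂ} (hu : (Function.support u).Finite)
    (h : ∑ᶠ x, conj (u x) * covLap η (1 : Site d → Fin d → ℂˣ) u x = 0) : ∀ (x : Site d) (μ : Fin d), u (x + e μ) = u x := by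
  classical
  rw [finsum_conj_mul_covLap_self η hu] at h
  have hgrad : ∀ μ : Fin d, (Function.support fun x => u (x + e μ) - u x).Finite := by
    intro μ
    refine (hu.union (hu.image fun x => x - e μ)).subset fun x hx => ?_
    rw [Function.mem_support] at hx
    by_contra h'
    simp only [Set.mem_union, Function.mem_support, Set.mem_image, not_or, not_exists, not_and, not_not] at h'
    apply hx
    have h1 : u x = 0 := h'.1
    have h2 : u (x + e μ) = 0 := by
      by_contra h2
      exact h'.2 (x + e μ) h2 (by abel)
    rw [h1, h2, sub_zero]
  have hc : ((η : ℂ) ^ 2)⁻¹ ≠ 0 := inv_ne_zero (pow_ne_zero 2 (Complex.ofReal_ne_zero.2 hη))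
  -- each term is `c · (a non-negative real)`; the sum vanishes, so each does
  have hterm : ∀ μ : Fin d, ∑ᶠ x, conj (u (x + e μ) - u x) * (u (x + e μ) - u x) =
      ((∑ x ∈ (hgrad μ).toFinset, ‖u (x + e μ) - u x‖ ^ 2 : ℝ) : ℂ) := fun μ => finsum_conj_mul_self_eq (hgrad μ)
  simp_rw [hterm] at h
  rw [← Finset.mul_sum, mul_eq_zero] at h
  rcases h with h | h
  · exact absurd h hc
  · have h' : ∑ μ : Fin d, ∑ x ∈ (hgrad μ).toFinset, ‖u (x + e μ) - u x‖ ^ 2 = 0 := by exact_mod_cast h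
    have hall := (Finset.sum_eq_zero_iff_of_nonneg fun μ _ => Finset.sum_nonneg fun x _ => sq_nonneg _).1 h'
    intro x μ
    have hμ := hall μ (Finset.mem_univ μ)
    have hz : (fun x => u (x + e μ) - u x) = 0 :=
      eq_zero_of_finsum_conj_mul_self_eq_zero (hgrad μ) (by rw [hterm μ]; exact_mod_cast hμ)
    have := congrFun hz x
    simp only [Pi.zero_apply, sub_eq_zero] at this
    exact this


/-! ## §2 The block sum of a shell mode is non-zero; its crossing datum on print's class is non-zero -/

open B7Prop4GeneralLevels (linCovIter)
open B8Eq146AExpansion (iEta)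
open B8Ineq159FlatCubeMemberPrinted (cubeLamBP crossing_mem_cubeLamBP_one)
open B8Ineq159FlatShellModeVacuity (sqLo_inBox_one)
open B8SockB9P3ShellModeVacuityUniv (indicator_covDivB_grad_eq linCovIter_one_grad_level_one)
open Literature.MathematicalPhysics.QuantumLattice (blockBase)

/-- The point `L•z + r`, `r ∈ [0, L)ᵈ`, lies in the block `B(z)`. [cite: Balaban1985Averaging, (2) p.17 + (78) p.30] -/
theorem smul_add_boxVec_mem_blockSites (L : ℕ) (z : Site d) (r : Fin d → Fin L) :
    (L : ℤ) • z + boxVec L r ∈ blockSites L z := by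
  classical
  rw [blockSites, Finset.mem_image]
  refine ⟨fun i => (r i : ℕ), Fintype.mem_piFinset.2 fun i => Finset.mem_range.2 (r i).isLt, ?_⟩
  funext i
  simp [blockBase, boxVec]

/-- ★★ **THE COMMON BLOCK SUM OF A SHELL MODE IS NON-ZERO** (ref-E NOTE-1, the energy identity): if `λ ≠ 0` is supported in `□₁`, has equal
`L`-block sums `S` over `□₁^{(1)}`, and `Δ^η_1(𝟙_{□₀}·D^{η*}_1∂λ)` is constant on the `L`-blocks of `□₁`, then `S ≠ 0` — for `S = 0` would give
`Σ_x λ̄·(Δ^η_1)²λ = S̄·Σ_β c_β = 0 = ‖Δ^η_1λ‖²`, so `Δ^η_1λ = 0`, so `‖∇λ‖² = 0`, so `λ` is constant along every lattice direction and finitely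
supported, i.e. `0` (`d ≥ 1`, `ρ ≥ 1`, `k ≥ 1`). [cite: Balaban1984PropagatorsII, (2.11) p.225 (positivity of Δ on N(Q′)); Balaban1985RegularSpaces, (1.38) p.82, (1.131) p.99] -/
theorem shellMode_blockSum_ne_zero (hd : 1 ≤ d) {L : ℕ} (hL : 1 ≤ L) {η : ℝ} (hη : 0 < η) (a : Site d) (M : ℕ) {ρ : ℕ} (hρ : 1 ≤ ρ)
    {k : ℕ} (hk : 1 ≤ k) {lam : Site d → ℂ}
    (hsupp : ∀ x, x ∉ cube L a M ρ k 1 → lam x = 0) (hne : ∃ x, lam x ≠ 0)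
    (hsum : ∀ z z', InBox (sqLo L a ρ k 1) (sqHi L a M ρ k 1) z → InBox (sqLo L a ρ k 1) (sqHi L a M ρ k 1) z' →
        ∑ r : Fin d → Fin L, lam ((L : ℤ) • z + boxVec L r) = ∑ r : Fin d → Fin L, lam ((L : ℤ) • z' + boxVec L r))
    (hlan : ∀ x ∈ cube L a M ρ k 1, ∀ x' ∈ cube L a M ρ k 1, blockMap (L ^ 1) x = blockMap (L ^ 1) x' →
        covLap η (1 : Site d → Fin d → ℂˣ) ((cube L a M ρ k 0).indicator
            (covDivB η (1 : Site d → Fin d → ℂˣ) (fun y κ => covDerivFwd η (1 : Site d → Fin d → ℂˣ) κ lam y))) x =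
        covLap η (1 : Site d → Fin d → ℂˣ) ((cube L a M ρ k 0).indicator
            (covDivB η (1 : Site d → Fin d → ℂˣ) (fun y κ => covDerivFwd η (1 : Site d → Fin d → ℂˣ) κ lam y))) x') :
    ∀ z, InBox (sqLo L a ρ k 1) (sqHi L a M ρ k 1) z → ∑ r : Fin d → Fin L, lam ((L : ℤ) • z + boxVec L r) ≠ 0 := by
  classical
  haveI : NeZero L := ⟨by omega⟩
  intro z₀ hz₀ hS0
  have hS : ∀ z, InBox (sqLo L a ρ k 1) (sqHi L a M ρ k 1) z → ∑ r : Fin d → Fin L, lam ((L : ℤ) • z + boxVec L r) = 0 :=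
    fun z hz => by rw [hsum z z₀ hz hz₀, hS0]
  -- the Landau quantity is `(Δ^η_1)²λ`
  set P : (Site d → ℂ) → Site d → ℂ := fun f x => covLap η (1 : Site d → Fin d → ℂˣ) f x with hP
  have hg : covDivB η (1 : Site d → Fin d → ℂˣ) (fun y κ => covDerivFwd η (1 : Site d → Fin d → ℂˣ) κ lam y) = P lam := by
    funext x; rfl
  have hH : ∀ x, covLap η (1 : Site d → Fin d → ℂˣ) ((cube L a M ρ k 0).indicator
      (covDivB η (1 : Site d → Fin d → ℂˣ) (fun y κ => covDerivFwd η (1 : Site d → Fin d → ℂˣ) κ lam y))) x = P (P lam) x := by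
    intro x; rw [indicator_covDivB_grad_eq η hρ hk hsupp, hg]
  -- supports
  have hfin1 : (cube L a M ρ k 1).Finite := inBox_finite _ _
  have hsuppLam : (Function.support lam).Finite := hfin1.subset fun x hx => by
    by_contra h; exact hx (hsupp x h)
  have hsuppP : (Function.support (P lam)).Finite := support_covLap_finite η hsuppLam
  -- `⟨λ, P²λ⟩ = 0` by the block decomposition of `□₁`
  set B₁ : Finset (Site d) := (inBox_finite (sqLo L a ρ k 1) (sqHi L a M ρ k 1)).toFinset with hB₁
  have hB₁mem : ∀ z, z ∈ B₁ ↔ InBox (sqLo L a ρ k 1) (sqHi L a M ρ k 1) z := fun z => by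
    rw [hB₁, Set.Finite.mem_toFinset]; rfl
  have hsub : Function.support (fun x => conj (lam x) * P (P lam) x) ⊆ ↑(B₁.biUnion fun z => blockSites L z) := by
    intro x hx
    rw [Function.mem_support] at hx
    have hxl : lam x ≠ 0 := fun h => hx (by rw [h, map_zero, zero_mul])
    have hx1 : x ∈ cube L a M ρ k 1 := by by_contra h; exact hxl (hsupp x h)
    obtain ⟨z, hz, hu⟩ := (mem_cube_iff hL).1 hx1
    rw [Finset.coe_biUnion, Set.mem_iUnion₂]
    refine ⟨z, (hB₁mem z).2 hz, ?_⟩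
    rw [Finset.mem_coe, mem_blockSites_iff]
    have := (under_iff_blockMap_eq hL 1 z x).1 hu
    rwa [pow_one] at this
  have hdisj : (↑B₁ : Set (Site d)).PairwiseDisjoint fun z => blockSites L z := by
    intro z _ z' _ hzz'
    rw [Function.onFun, Finset.disjoint_left]
    intro x hx hx'
    rw [mem_blockSites_iff] at hx hx'
    exact hzz' (hx.symm.trans hx')
  have hzero : ∑ᶠ x, conj (lam x) * P (P lam) x = 0 := by
    rw [finsum_eq_sum_of_support_subset _ hsub, Finset.sum_biUnion hdisj]
    refine Finset.sum_eq_zero fun z hz => ?_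
    have hzB := (hB₁mem z).1 hz
    rw [B7Eq214FlatQprime.sum_blockSites_eq_sum_boxVec]
    -- `P²λ` is constant on the block
    have hconst : ∀ r : Fin d → Fin L, P (P lam) ((L : ℤ) • z + boxVec L r) = P (P lam) (((L : ℤ) ^ 1) • z) := by
      intro r
      have hx1 : (L : ℤ) • z + boxVec L r ∈ cube L a M ρ k 1 := by
        refine (mem_cube_iff hL).2 ⟨z, hzB, (under_iff_blockMap_eq hL 1 z _).2 ?_⟩
        rw [pow_one]; exact (mem_blockSites_iff L z _).1 (smul_add_boxVec_mem_blockSites L z r)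
      have hx2 : ((L : ℤ) ^ 1) • z ∈ cube L a M ρ k 1 := (smul_mem_cube_iff hL a M ρ k 1 z).2 hzB
      have hbb : blockMap (L ^ 1) ((L : ℤ) • z + boxVec L r) = blockMap (L ^ 1) (((L : ℤ) ^ 1) • z) := by
        rw [B8Ineq159FlatShellModeVacuity.blockMap_smul_self hL z, pow_one]
        exact (mem_blockSites_iff L z _).1 (smul_add_boxVec_mem_blockSites L z r)
      rw [← hH, ← hH]
      exact hlan _ hx1 _ hx2 hbb
    simp_rw [hconst]
    rw [← Finset.sum_mul, ← map_sum, hS z hzB, map_zero, zero_mul]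
  -- hence `Pλ = 0`, hence `λ` is shift invariant, hence `0`
  rw [finsum_conj_mul_covLap_symm η hsuppLam hsuppP] at hzero
  have hPlam : P lam = 0 := eq_zero_of_finsum_conj_mul_self_eq_zero hsuppP hzero
  have hDir : ∑ᶠ x, conj (lam x) * covLap η (1 : Site d → Fin d → ℂˣ) lam x = 0 := by
    have : ∀ x, covLap η (1 : Site d → Fin d → ℂˣ) lam x = 0 := fun x => congrFun hPlam x
    simp_rw [this, mul_zero]
    exact finsum_zero
  have hshift := shift_eq_of_finsum_conj_mul_covLap_self_eq_zero hη.ne' hsuppLam hDir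
  obtain ⟨x₀, hx₀⟩ := hne
  set μ₀ : Fin d := ⟨0, by omega⟩
  have hall : ∀ t : ℕ, lam (x₀ + (t : ℤ) • e μ₀) = lam x₀ := by
    intro t
    induction t with
    | zero => simp
    | succ t ih => rw [show x₀ + ((t + 1 : ℕ) : ℤ) • e μ₀ = x₀ + (t : ℤ) • e μ₀ + e μ₀ by push_cast; rw [add_smul, one_smul, add_assoc],
        hshift, ih]
  have hmem : ∀ t : ℕ, x₀ + (t : ℤ) • e μ₀ ∈ cube L a M ρ k 1 := fun t => by
    by_contra h; exact hx₀ (by rw [← hall t]; exact hsupp _ h)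
  have hinj : Function.Injective (fun t : ℕ => x₀ + (t : ℤ) • e μ₀) := by
    intro t t' h
    have := congrFun h μ₀
    simp only [Pi.add_apply, Pi.smul_apply, smul_eq_mul, e, Pi.single_eq_same, mul_one, add_right_inj] at this
    omega
  exact (Set.infinite_range_of_injective hinj) (hfin1.subset (by rintro _ ⟨t, rfl⟩; exact hmem t))

/-- ★★ **THE REPAIR BITES: ON PRINT'S CLASS THE SHELL MODE HAS A NON-ZERO DATUM.** For every shell mode `λ` (as above, bounded) the averaging
datum `L·Q₁(1)(iη∂λ)` on the crossing bond `⟨s − e₀, s⟩` of print's class `cubeLamBP … m 1` (`s` = lower corner of `□₁^{(1)}`, a member by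
`B8Ineq159FlatCubeMemberPrinted.crossing_mem_cubeLamBP_one`) equals `L^{−d}·i·S ≠ 0`: the zero modes of `B8Ineq159FlatShellModeVacuity` do NOT
inhabit the data of the repaired statement `Ineq159FlatCubeMemberPrinted`. [cite: Balaban1985RegularSpaces, (1.31) p.82, (1.59) p.86, (1.131) p.99; Balaban1984PropagatorsII, (2.3) p.224, (2.11) p.225] -/
theorem shellMode_crossing_datum_ne_zero (hd : 1 ≤ d) {L : ℕ} (hL : 1 ≤ L) {η : ℝ} (hη : 0 < η) (a : Site d) (M : ℕ) {ρ : ℕ}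
    (hρ : 1 ≤ ρ) {k m : ℕ} (hk : 1 ≤ k) (hm : 1 ≤ m) {lam : Site d → ℂ}
    (hsupp : ∀ x, x ∉ cube L a M ρ k 1 → lam x = 0) (hne : ∃ x, lam x ≠ 0) (hbdd : ∃ Λ : ℝ, ∀ x, ‖lam x‖ ≤ Λ)
    (hsum : ∀ z z', InBox (sqLo L a ρ k 1) (sqHi L a M ρ k 1) z → InBox (sqLo L a ρ k 1) (sqHi L a M ρ k 1) z' →
        ∑ r : Fin d → Fin L, lam ((L : ℤ) • z + boxVec L r) = ∑ r : Fin d → Fin L, lam ((L : ℤ) • z' + boxVec L r))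
    (hlan : ∀ x ∈ cube L a M ρ k 1, ∀ x' ∈ cube L a M ρ k 1, blockMap (L ^ 1) x = blockMap (L ^ 1) x' →
        covLap η (1 : Site d → Fin d → ℂˣ) ((cube L a M ρ k 0).indicator
            (covDivB η (1 : Site d → Fin d → ℂˣ) (fun y κ => covDerivFwd η (1 : Site d → Fin d → ℂˣ) κ lam y))) x =
        covLap η (1 : Site d → Fin d → ℂˣ) ((cube L a M ρ k 0).indicator
            (covDivB η (1 : Site d → Fin d → ℂˣ) (fun y κ => covDerivFwd η (1 : Site d → Fin d → ℂˣ) κ lam y))) x') :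
    (sqLo L a ρ k 1 - e ⟨0, hd⟩, (⟨0, hd⟩ : Fin d)) ∈ cubeLamBP L a M ρ k m 1 ∧
      linCovIter L (1 : Site d → Fin d → ℂˣ) (iEta η (fun y τ => covDerivFwd η (1 : Site d → Fin d → ℂˣ) τ lam y)) 1
        (sqLo L a ρ k 1 - e ⟨0, hd⟩) ⟨0, hd⟩ ≠ 0 := by
  classical
  haveI : NeZero L := ⟨by omega⟩
  refine ⟨(crossing_mem_cubeLamBP_one hd L a M hρ k hm).1, ?_⟩
  obtain ⟨Λ, hΛ⟩ := hbdd
  rw [linCovIter_one_grad_level_one hL hη hΛ, sub_add_cancel]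
  -- the outer block carries no `λ`
  have hout : ∑ r : Fin d → Fin L, lam ((L : ℤ) • (sqLo L a ρ k 1 - e ⟨0, hd⟩) + boxVec L r) = 0 := by
    refine Finset.sum_eq_zero fun r _ => hsupp _ fun hx => ?_
    obtain ⟨z, hz, hu⟩ := (mem_cube_iff hL).1 hx
    have h1 : blockMap (L ^ 1) ((L : ℤ) • (sqLo L a ρ k 1 - e ⟨0, hd⟩) + boxVec L r) = z := (under_iff_blockMap_eq hL 1 z _).1 hu
    have h2 : blockMap (L ^ 1) ((L : ℤ) • (sqLo L a ρ k 1 - e ⟨0, hd⟩) + boxVec L r) = sqLo L a ρ k 1 - e ⟨0, hd⟩ := by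
      rw [pow_one]; exact (mem_blockSites_iff L _ _).1 (smul_add_boxVec_mem_blockSites L _ r)
    have hzeq : z = sqLo L a ρ k 1 - e ⟨0, hd⟩ := h1.symm.trans h2
    have := (hz ⟨0, hd⟩).1
    rw [hzeq] at this
    simp [e] at this
  rw [hout, sub_zero]
  have hS := shellMode_blockSum_ne_zero hd hL hη a M hρ hk hsupp hne hsum hlan _ (sqLo_inBox_one L a M hρ k)
  refine smul_ne_zero (inv_ne_zero (pow_ne_zero _ (by exact_mod_cast (show L ≠ 0 by omega)))) ?_
  exact mul_ne_zero Complex.I_ne_zero hS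

#print axioms shellMode_crossing_datum_ne_zero

end Literature.MathematicalPhysics.QuantumFieldTheory.Balaban1983to89.B8Ineq159FlatShellModeCrossingDatum

end
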